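import Literature.NumberTheory.GaloisRepresentations.HomDualIdeleReadoutS
import Literature.NumberTheory.GaloisRepresentations.IdeleTruncatedSExtOneVanishing
import HarnessLib

/-!
# The `S`-readout on `Ext¹_{C_{G_S}}(M^{N_S}, I_S)`: descent of `R_v^S` through the boundary
# `δ : Hom_{G_S}(N₁^S, I_S) ↠ Ext¹(M^{N_S}, I_S)`, and (R3) on `Ext¹` (Milne ADT I Lemma 4.13, Thm. 4.10 (a); Harari Prop. 17.26)

Topic `NumberTheory/GaloisRepresentations`; namespace `Literature.NumberTheory.GaloisRepresentations.HomDual`.  Sequel to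
`HomDualIdeleReadoutS.lean` (`readoutS`: door-c6's idèle readout of `e₁⁻¹ ≫ f♯` for `f : N₁^S ⟶ I_S`; (R1)_S; (R3)_S at class
level) and `IdeleTruncatedSExtOneVanishing.lean` (`exists_extClass_comp_mk₀_eq`: the boundary `f ↦ δ_S ∘ [f]` is ONTO
`Ext¹_{C_{G_S}}(M^{N_S}, I_S)`, since `Ext¹_{C_{G_S}}(P^S, I_S) = 0`).  Plumbing definitions with bodies (`bdrySHom`, **`readoutSExt`**)
and theorems; NO named fact, no `sorry`, no instance, no notation.

THE MATHEMATICS (Milne I, proof of Thm. 4.10 (a) on the `Ext` road, p. 58, for `G_S`; Harari Prop. 17.26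
`Ext¹_{G_S}(M^D, I_S) ≅ P¹_S`).  With the `S`-presentation `0 → N₁^S → P^S → M^{N_S} → 0` in `C_{G_S}` and its boundary
`δ : Hom_{G_S}(N₁^S, I_S) → Ext¹_{C_{G_S}}(M^{N_S}, I_S)`, `f ↦ δ_S ∘ [f]` (`bdrySHom`, additive): `δ` is onto (previous file) and
`δ f = δ f'` forces `f - f' = f^S ≫ q` (exactness of `Ext(–, I_S)` at `Hom(N₁^S, I_S)`), on which every `R_v^S` vanishes ((R1)_S).
Hence `R_v^S` DESCENDS to an additive **`readoutSExt ρ n S hur hM v : Ext¹_{C_{G_S}}(M^{N_S}, I_S) →+ H¹(K_v, ρ^∨(1))`**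
with `readoutSExt (δ f) = readoutS f` (`readoutSExt_bdryS`), vanishing at finite `v ∉ S`, and satisfying (R3) on `Ext¹`
(**`exists_forall_mem_readoutSExt_eq`**) — VERBATIM the datum `R : ∀ v, Ext A T.X₂ 1 →+ galoisCohomology (ρ_sk.toLocal v) 1`
and the hypothesis `hR3` of -w2 g11's `ShaExtRoad.pairing_perfect` for `A := (presentationComplexS ρ ↑S).X₃`, `T := truncSeqS K S`
(`T.X₂ = truncIdeleBarD K S`), `ρ_sk := ρ.tateDual n`.

Cell bsd-eis, lane «PT-Ш-S-TC», brick D4b step F2g (seat bsd-line-x1-p1-w6 gen 11).  HONEST FRAMING: bookkeeping; no case of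
Poitou–Tate or BSD is proved here; (R4)_S (the pairing dictionary with `inv_S`) is not addressed.

## References
* J. S. Milne, *Arithmetic Duality Theorems*, 2nd ed. (2006), I Lemma 4.13, I Thm. 4.10 (a) (proof, p. 58), I §0 (0.8). [MilneADT2006]
* D. Harari, *Galois Cohomology and Class Field Theory* (2020), Prop. 17.26 (proof), Lemma 17.23. [Harari2020]
-/

noncomputable section

open NumberField IsDedekindDomain CategoryTheory CategoryTheory.Abelian
open Field (absoluteGaloisGroup)
open Literature.NumberTheory.Automorphic Literature.Algebra.Homology Literature.Algebra.Homology.DiscreteRep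
open scoped Classical

namespace Literature.NumberTheory.GaloisRepresentations

namespace HomDual

open IdeleClassBar IdeleReadout FreePresentation DGMBridge DiscreteGaloisModule

variable {K : Type} [Field K] [NumberField K]
variable {M : Type} [AddCommGroup M] [TopologicalSpace M] [DiscreteTopology M] [Finite M]
variable (ρ : DiscreteGaloisModule K M) (n : ℕ) [NeZero n]
variable (S : Finset (HeightOneSpectrum (𝓞 K)))
  (hur : ramificationSubgroup K (↑S : Set (HeightOneSpectrum (𝓞 K))) ≤ ContinuousRep.ker ρ)

/-! ## §1. The boundary `δ : Hom_{G_S}(N₁^S, I_S) →+ Ext¹_{C_{G_S}}(M^{N_S}, I_S)` and its fibres -/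

/-- **The boundary `f ↦ δ_S ∘ [f]`** of the `S`-presentation, as an additive map
`Hom_{G_S}(N₁^S, I_S) →+ Ext¹_{C_{G_S}}(M^{N_S}, I_S)`. [cite: MilneADT2006, I Thm. 4.10 (a) (proof, p. 58)] -/
def bdrySHom : ((presentationComplexS ρ (↑S : Set (HeightOneSpectrum (𝓞 K)))).X₁ ⟶ truncIdeleBarD K S) →+
    Ext (presentationComplexS ρ (↑S : Set (HeightOneSpectrum (𝓞 K)))).X₃ (truncIdeleBarD K S) 1 where
  toFun f := (presentationComplexS_shortExact ρ (↑S : Set (HeightOneSpectrum (𝓞 K))) hur).extClass.comp (Ext.mk₀ f)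
    (add_zero 1)
  map_zero' := by rw [Ext.mk₀_zero, Ext.comp_zero]
  map_add' f g := by rw [Ext.mk₀_add, Ext.comp_add]

/-- Unfolding. [cite: MilneADT2006, I Thm. 4.10 (a) (proof, p. 58)] -/
theorem bdrySHom_apply (f : (presentationComplexS ρ (↑S : Set (HeightOneSpectrum (𝓞 K)))).X₁ ⟶ truncIdeleBarD K S) :
    bdrySHom ρ S hur f =
      (presentationComplexS_shortExact ρ (↑S : Set (HeightOneSpectrum (𝓞 K))) hur).extClass.comp (Ext.mk₀ f) (add_zero 1) :=
  rfl

/-- **`δ` is onto** (`Ext¹_{C_{G_S}}(P^S, I_S) = 0`, previous file). [cite: MilneADT2006, I Lemma 4.13] [cite: Harari2020, Lemma 17.23] -/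
theorem bdrySHom_surjective : Function.Surjective (bdrySHom ρ S hur) :=
  extClass_comp_mk₀_surjective S ρ hur

/-- **The fibres of `δ`**: `δ f = 0` iff `f` extends to `P^S`, i.e. `f = f^S ≫ q` for some `q : P^S ⟶ I_S` (exactness of
`Hom(P^S, I_S) → Hom(N₁^S, I_S) → Ext¹(M^{N_S}, I_S)`). [cite: MilneADT2006, I §0 (0.8), I Thm. 4.10 (a) (proof)] -/
theorem exists_f_comp_eq_of_bdrySHom_eq_zero
    {f : (presentationComplexS ρ (↑S : Set (HeightOneSpectrum (𝓞 K)))).X₁ ⟶ truncIdeleBarD K S} (hf : bdrySHom ρ S hur f = 0) :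
    ∃ q : (presentationComplexS ρ (↑S : Set (HeightOneSpectrum (𝓞 K)))).X₂ ⟶ truncIdeleBarD K S,
      (presentationComplexS ρ (↑S : Set (HeightOneSpectrum (𝓞 K)))).f ≫ q = f := by
  obtain ⟨x₂, hx₂⟩ := Ext.contravariant_sequence_exact₁
    (presentationComplexS_shortExact ρ (↑S : Set (HeightOneSpectrum (𝓞 K))) hur) _ (Ext.mk₀ f) (add_zero 1) hf
  obtain ⟨q, rfl⟩ := (Ext.mk₀_bijective _ _).2 x₂
  rw [Ext.mk₀_comp_mk₀] at hx₂
  exact ⟨q, (Ext.mk₀_bijective _ _).1 hx₂⟩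

/-- **`R_v^S` is constant on the fibres of `δ`** ((R1)_S: the readout of a morphism extending to `P^S` vanishes).
[cite: MilneADT2006, I Lemma 4.13 (proof), Thm. 4.10 (a) (proof, p. 58)] -/
theorem readoutS_eq_of_bdrySHom_eq (hM : ∀ m : M, n • m = 0) (v : Place K)
    {f f' : (presentationComplexS ρ (↑S : Set (HeightOneSpectrum (𝓞 K)))).X₁ ⟶ truncIdeleBarD K S}
    (h : bdrySHom ρ S hur f = bdrySHom ρ S hur f') : readoutS ρ n S hur hM v f = readoutS ρ n S hur hM v f' := by
  have h0 : bdrySHom ρ S hur (f - f') = 0 := by rw [map_sub, h, sub_self]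
  obtain ⟨q, hq⟩ := exists_f_comp_eq_of_bdrySHom_eq_zero ρ S hur h0
  rw [← sub_eq_zero, ← map_sub, ← hq]
  exact readoutS_f_comp ρ n S hur hM v q

/-! ## §2. The readout on `Ext¹_{C_{G_S}}(M^{N_S}, I_S)` -/

/-- A chosen `δ`-preimage. [cite: MilneADT2006, I Thm. 4.10 (a) (proof, p. 58)] -/
def bdrySLift (x : Ext (presentationComplexS ρ (↑S : Set (HeightOneSpectrum (𝓞 K)))).X₃ (truncIdeleBarD K S) 1) :
    (presentationComplexS ρ (↑S : Set (HeightOneSpectrum (𝓞 K)))).X₁ ⟶ truncIdeleBarD K S :=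
  Classical.choose (bdrySHom_surjective ρ S hur x)

/-- The chosen preimage is a preimage. [cite: MilneADT2006, I Thm. 4.10 (a) (proof, p. 58)] -/
@[simp]
theorem bdrySHom_bdrySLift (x : Ext (presentationComplexS ρ (↑S : Set (HeightOneSpectrum (𝓞 K)))).X₃ (truncIdeleBarD K S) 1) :
    bdrySHom ρ S hur (bdrySLift ρ S hur x) = x :=
  Classical.choose_spec (bdrySHom_surjective ρ S hur x)

/-- **The `S`-readout on `Ext¹_{C_{G_S}}(M^{N_S}, I_S)`**: `R_v^S` of any `δ`-preimage (well defined by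
`readoutS_eq_of_bdrySHom_eq`).  This is the datum `R v` of -w2 g11's `ShaExtRoad` for `T := truncSeqS K S`,
`A := (presentationComplexS ρ S).X₃`. [cite: MilneADT2006, I Thm. 4.10 (a) (proof, p. 58), Lemma 4.13] [cite: Harari2020, Prop. 17.26] -/
def readoutSExt (hM : ∀ m : M, n • m = 0) (v : Place K) :
    Ext (presentationComplexS ρ (↑S : Set (HeightOneSpectrum (𝓞 K)))).X₃ (truncIdeleBarD K S) 1 →+
      galoisCohomology ((ρ.tateDual n).toLocal v) 1 where
  toFun x := readoutS ρ n S hur hM v (bdrySLift ρ S hur x)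
  map_zero' := by
    rw [readoutS_eq_of_bdrySHom_eq ρ n S hur hM v (f' := 0) (by rw [bdrySHom_bdrySLift, map_zero]), map_zero]
  map_add' x y := by
    rw [readoutS_eq_of_bdrySHom_eq ρ n S hur hM v (f' := bdrySLift ρ S hur x + bdrySLift ρ S hur y)
      (by rw [bdrySHom_bdrySLift, map_add, bdrySHom_bdrySLift, bdrySHom_bdrySLift]), map_add]

/-- **`readoutSExt (δ f) = readoutS f`.** [cite: MilneADT2006, I Thm. 4.10 (a) (proof, p. 58)] -/
@[simp]
theorem readoutSExt_bdryS (hM : ∀ m : M, n • m = 0) (v : Place K)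
    (f : (presentationComplexS ρ (↑S : Set (HeightOneSpectrum (𝓞 K)))).X₁ ⟶ truncIdeleBarD K S) :
    readoutSExt ρ n S hur hM v (bdrySHom ρ S hur f) = readoutS ρ n S hur hM v f :=
  readoutS_eq_of_bdrySHom_eq ρ n S hur hM v (bdrySHom_bdrySLift ρ S hur _)

/-- The same with the boundary written out. [cite: MilneADT2006, I Thm. 4.10 (a) (proof, p. 58)] -/
theorem readoutSExt_extClass_comp_mk₀ (hM : ∀ m : M, n • m = 0) (v : Place K)
    (f : (presentationComplexS ρ (↑S : Set (HeightOneSpectrum (𝓞 K)))).X₁ ⟶ truncIdeleBarD K S) :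
    readoutSExt ρ n S hur hM v
      ((presentationComplexS_shortExact ρ (↑S : Set (HeightOneSpectrum (𝓞 K))) hur).extClass.comp (Ext.mk₀ f) (add_zero 1)) =
      readoutS ρ n S hur hM v f :=
  readoutSExt_bdryS ρ n S hur hM v f

/-- **`readoutSExt = 0` at a finite place `v ∉ S`.** [cite: Harari2020, Lemma 15.39, Prop. 17.26] -/
theorem readoutSExt_inr_eq_zero_of_not_mem (hM : ∀ m : M, n • m = 0) {v : HeightOneSpectrum (𝓞 K)} (hv : v ∉ S)
    (x : Ext (presentationComplexS ρ (↑S : Set (HeightOneSpectrum (𝓞 K)))).X₃ (truncIdeleBarD K S) 1) :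
    readoutSExt ρ n S hur hM (Sum.inr v) x = 0 :=
  readoutS_inr_eq_zero_of_not_mem ρ n S hur hM hv _

/-! ## §3. (R3) on `Ext¹` -/

/-- **(R3) on `Ext¹_{C_{G_S}}(M^{N_S}, I_S)`**: every family of local classes is `(readoutSExt v x)_{v ∈ Sig}` for one `x`,
`Sig = S ∪ Ω_∞` — VERBATIM `hR3` of `ShaExtRoad.pairing_perfect` with `R v := readoutSExt ρ n S hur hM v`.
[cite: MilneADT2006, I Thm. 4.10 (a) (proof, p. 58), Lemma 4.13] [cite: Harari2020, Prop. 17.26] -/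
theorem exists_forall_mem_readoutSExt_eq (hM : ∀ m : M, n • m = 0) (Sig : Finset (Place K))
    (hSig₂ : ∀ v : HeightOneSpectrum (𝓞 K), (Sum.inr v : Place K) ∈ Sig ↔ v ∈ S)
    (t : Π v : Place K, galoisCohomology ((ρ.tateDual n).toLocal v) 1) :
    ∃ x : Ext (presentationComplexS ρ (↑S : Set (HeightOneSpectrum (𝓞 K)))).X₃ (truncIdeleBarD K S) 1,
      ∀ v ∈ Sig, readoutSExt ρ n S hur hM v x = t v := by
  obtain ⟨f, hf⟩ := exists_forall_mem_readoutS_eq ρ n S hur hM Sig hSig₂ t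
  exact ⟨bdrySHom ρ S hur f, fun v hv => by rw [readoutSExt_bdryS]; exact hf v hv⟩

/-- (R3) on `Ext¹`, split form (`v ∈ S` and the infinite places). [cite: MilneADT2006, I Lemma 4.13] -/
theorem exists_readoutSExt_eq (hM : ∀ m : M, n • m = 0) (t : Π v : Place K, galoisCohomology ((ρ.tateDual n).toLocal v) 1) :
    ∃ x : Ext (presentationComplexS ρ (↑S : Set (HeightOneSpectrum (𝓞 K)))).X₃ (truncIdeleBarD K S) 1,
      (∀ v ∈ S, readoutSExt ρ n S hur hM (Sum.inr v) x = t (Sum.inr v)) ∧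
      (∀ w : InfinitePlace K, readoutSExt ρ n S hur hM (Sum.inl w) x = t (Sum.inl w)) := by
  obtain ⟨f, hfin, hinf⟩ := exists_readoutS_eq ρ n S hur hM t
  exact ⟨bdrySHom ρ S hur f, fun v hv => by rw [readoutSExt_bdryS]; exact hfin v hv,
    fun w => by rw [readoutSExt_bdryS]; exact hinf w⟩

end HomDual

end Literature.NumberTheory.GaloisRepresentations

end
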